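import Summits.CriticalPhenomena.PercolationContinuityZ3.Theses.PercNonProliferation
import Literature.Probability.Percolation.HalfSpace
import Literature.Probability.Percolation.HalfSpacePinnedPairs
import Literature.Probability.Percolation.SubgraphMonotonicity
import Literature.Probability.Percolation.Crossings
import Literature.Probability.Percolation.SharpnessDCTProofs

/-!
# Sketch — crux-ideate stmt-CriticalPhenomena-4446 (SubpolynomialBlocking), round 1, ideator 2

First lemmas of the two idea cards `cutset-rsw-tube-seed` and `slab-ladder-two-curtains`.
PROVED (no sorry): `curtain_antitone` (blocking is antitone in `p`), `pc_le_pcSlab`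
(`p_c(ℤ³) ≤ p_c(S_k)`), the LADDER `subpolynomialBlocking_of_slabCurtainSubpoly` (modulo the
Harris step `block_ge_curtain_sq`, left as a stub), and the full bookkeeping reduction
`subpolynomialBlocking_of_cutsetRSW_tubeRate : CutsetRSW → TubeRate → SubpolynomialBlocking`.
Remaining `sorry`s are STUBS of the lines (deterministic inclusions `two_curtains_subset`,
`chain_glue`; Harris+symmetry `block_ge_curtain_sq`; independence `tubeRate_of_subpolynomialBlocking`).
Decls live in `…Cruxes.SubpolynomialBlocking.Ideate2` to avoid clashing with anything.
-/

noncomputable section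

namespace Summit.CriticalPhenomena.PercolationContinuityZ3.Cruxes.SubpolynomialBlocking.Ideate2

open Literature.Probability.LatticeModels Literature.Probability.Percolation Filter MeasureTheory

/-- The critical bond measure on `ℤ³`. -/
abbrev μc : Measure (BondConfig (Site 3)) := bondPercolation (zdGraph 3) (criticalProbI 3)

/-- The measure at parameter `p`. -/
abbrev μ (p : unitInterval) : Measure (BondConfig (Site 3)) := bondPercolation (zdGraph 3) p

/-- The crux's blocking event `Block_n = {no open path inside B(2n) from B(n) to ∂⁻B(2n)}`. -/
def blockEv (n : ℕ) : Set (BondConfig (Site 3)) :=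
  {ω | ¬ ∃ x ∈ box 3 n, ∃ y ∈ innerBoundary (zdGraph 3) (box 3 (2 * n)),
      ω ∈ openConnIn ↑(box 3 (2 * n)) x y}

/-- The crux, verbatim, is the statement `∀ s>0, eventually n^{-s} ≤ μc(Block_n)`. -/
theorem crux_iff :
    Theses.PercNonProliferation.SubpolynomialBlocking ↔
      ∀ s : ℝ, 0 < s → ∀ᶠ n : ℕ in atTop, (n : ℝ) ^ (-s) ≤ μc.real (blockEv n) :=
  Iff.rfl

/-! ## Card `slab-ladder-two-curtains` -/

/-- The column of half-width `n` along coordinate `0` inside `B(2n)`. -/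
def column0 (n : ℕ) : Set (Site 3) :=
  {v | v ∈ box 3 (2 * n) ∧ |v 1| ≤ (n : ℤ) ∧ |v 2| ≤ (n : ℤ)}

/-- Its lateral boundary inside `B(2n)`: `max(|v₁|,|v₂|) = 2n`. -/
def lateral0 (n : ℕ) : Set (Site 3) :=
  {v | v ∈ box 3 (2 * n) ∧ (|v 1| = 2 * (n : ℤ) ∨ |v 2| = 2 * (n : ℤ))}

/-- CURTAIN around the `0`-column: no open path inside `B(2n)` from the column to its lateral
boundary.  This is the slab event "`B̄_n ↮ ∂B̄_{2n}` in the slab `{|x₀| ≤ 2n}` of thickness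
`4n+1`" of Newman–Tassion–Wu 2017, Cor. 3.2 (4) (blocking closed surface in the slab annulus). -/
def curtain0 (n : ℕ) : Set (BondConfig (Site 3)) :=
  {ω | ¬ ∃ x ∈ column0 n, ∃ y ∈ lateral0 n, ω ∈ openConnIn ↑(box 3 (2 * n)) x y}

/-- The same objects with coordinate `2` as the column direction. -/
def column2 (n : ℕ) : Set (Site 3) :=
  {v | v ∈ box 3 (2 * n) ∧ |v 0| ≤ (n : ℤ) ∧ |v 1| ≤ (n : ℤ)}

/-- Lateral boundary of the `2`-column. -/
def lateral2 (n : ℕ) : Set (Site 3) :=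
  {v | v ∈ box 3 (2 * n) ∧ (|v 0| = 2 * (n : ℤ) ∨ |v 1| = 2 * (n : ℤ))}

/-- Curtain around the `2`-column. -/
def curtain2 (n : ℕ) : Set (BondConfig (Site 3)) :=
  {ω | ¬ ∃ x ∈ column2 n, ∃ y ∈ lateral2 n, ω ∈ openConnIn ↑(box 3 (2 * n)) x y}

/-- TWO-CURTAIN INCLUSION (deterministic, provable now): a path inside `B(2n)` from `B(n)` to
`∂⁻B(2n)` ends on a face `|v_i| = 2n`; if `i ∈ {1,2}` it crosses the `0`-column's annulus
(`B(n) ⊆ column0 n`), if `i ∈ {0,1}` it crosses the `2`-column's annulus. -/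
theorem two_curtains_subset (n : ℕ) (hn : 1 ≤ n) : curtain0 n ∩ curtain2 n ⊆ blockEv n := by
  sorry

/-- Harris–FKG for the two decreasing local events + the coordinate symmetry `0 ↔ 2`
(provable now from `harris_fkg_local` on complements and `bondPercolation_real_preimage` of a
coordinate permutation): `μ_p(Block_n) ≥ μ_p(curtain0 n)²`. -/
theorem block_ge_curtain_sq (p : unitInterval) (n : ℕ) (hn : 1 ≤ n) :
    (μ p).real (curtain0 n) ^ 2 ≤ (μ p).real (blockEv n) := by
  sorry

/-- Blocking is DECREASING, hence antitone in `p` (provable now from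
`real_mono_of_isUpperSet` applied to the complement). -/
theorem measurableSet_openCrossing_site (S A B : Set (Site 3)) :
    MeasurableSet (openCrossing S A B) := by
  have h : openCrossing S A B = ⋃ x ∈ A, ⋃ y ∈ B, openConnIn S x y := by
    ext ω; simp [openCrossing]
  rw [h]
  exact MeasurableSet.biUnion (Set.to_countable A) fun x _ =>
    MeasurableSet.biUnion (Set.to_countable B) fun y _ => measurableSet_openConnIn_of_countable S x y

/-- The curtain is the complement of an open crossing event. -/
theorem curtain0_eq_compl (n : ℕ) :
    curtain0 n = (openCrossing (↑(box 3 (2 * n)) : Set (Site 3)) (column0 n) (lateral0 n))ᶜ := by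
  ext ω; simp [curtain0, openCrossing]

theorem curtain_antitone (n : ℕ) {p q : unitInterval} (hpq : p ≤ q) :
    (μ q).real (curtain0 n) ≤ (μ p).real (curtain0 n) := by
  have hU := isUpperSet_openCrossing (↑(box 3 (2 * n)) : Set (Site 3)) (column0 n) (lateral0 n)
  have hM := measurableSet_openCrossing_site (↑(box 3 (2 * n)) : Set (Site 3)) (column0 n) (lateral0 n)
  have key := DCT16.real_mono_of_isUpperSet (zdGraph 3) hU hM hpq
  rw [curtain0_eq_compl, measureReal_compl hM, measureReal_compl hM, probReal_univ, probReal_univ]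
  linarith

/-- The critical point of the slab `S_k = {0 ≤ x₀ ≤ k}` of `ℤ³` (rooted at the origin). -/
def pcSlab (k : ℕ) : unitInterval := criticalProbIOf (slabGraph 3 k) (slabOrigin 3 k)

/-- `p_c(ℤ³) ≤ p_c(S_k)` (induced subgraph; `criticalProb_le_induce`-type monotonicity). -/
theorem pc_le_pcSlab (k : ℕ) : criticalProbI 3 ≤ pcSlab k :=
  Subtype.coe_le_coe.mp
    (criticalProb_le_induce theta_induce_le_holds (zdGraph 3) (slab 3 k) 0 (zero_mem_slab 3 k))

/-- ENGINE STATEMENT of the card (open): at the slab's OWN critical point the curtain-blocking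
probability of the slab of thickness `4n+1` at horizontal scale `n` decays slower than any
power of `n`.  (NTW 2017, Cor. 3.2 (4) gives `≥ c(k)` for each fixed `k` and all `n ≥ 1`; the
printed `c(k)` tends to `0` quickly; `k^{-o(1)}` at `n ≍ k/4` is what the crux needs.)  The
curtain event is measured here under the `ℤ³` product measure; it depends only on edges of
`B(2n) ⊆ {|x₀| ≤ 2n}`, a translate of `S_{4n}`, so this is the slab probability. -/
def SlabCurtainSubpoly : Prop :=
  ∀ s : ℝ, 0 < s → ∀ᶠ n : ℕ in atTop, (n : ℝ) ^ (-s) ≤ (μ (pcSlab (4 * n))).real (curtain0 n)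

/-- THE LADDER (provable now from the three lemmas above and `pc_le_pcSlab`):
`μc(Block_n) ≥ μc(curtain0 n)² ≥ μ_{p_c(S_{4n})}(curtain0 n)² ≥ n^{-2s}`. -/
theorem subpolynomialBlocking_of_slabCurtainSubpoly :
    SlabCurtainSubpoly → Theses.PercNonProliferation.SubpolynomialBlocking := by
  intro h s hs
  have h2 := h (s / 2) (by linarith)
  filter_upwards [h2, eventually_ge_atTop 1] with n hn hn1
  have hanti := curtain_antitone n (pc_le_pcSlab (4 * n))
  have hsq := block_ge_curtain_sq (criticalProbI 3) n hn1
  have hpos : 0 ≤ (n : ℝ) ^ (-(s / 2)) := Real.rpow_nonneg (Nat.cast_nonneg n) _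
  have hk : (n : ℝ) ^ (-(s / 2)) ≤ (μ (criticalProbI 3)).real (curtain0 n) := hn.trans hanti
  have hexp : ((n : ℝ) ^ (-(s / 2))) ^ 2 = (n : ℝ) ^ (-s) := by
    rw [← Real.rpow_natCast, ← Real.rpow_mul (Nat.cast_nonneg n)]
    congr 1; push_cast; ring
  calc (n : ℝ) ^ (-s) = ((n : ℝ) ^ (-(s / 2))) ^ 2 := hexp.symm
    _ ≤ ((μ (criticalProbI 3)).real (curtain0 n)) ^ 2 := pow_le_pow_left₀ hpos hk 2
    _ ≤ (μ (criticalProbI 3)).real (blockEv n) := hsq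

/-! ## Card `cutset-rsw-tube-seed` -/

/-- The lattice box `∏ᵢ [aᵢ, bᵢ]`. -/
def rect (a b : Site 3) : Set (Site 3) := {v | ∀ i, a i ≤ v i ∧ v i ≤ b i}

/-- CUTSET EVENT `Sh_i(rect a b)`: no open path inside the box from the face `{vᵢ = aᵢ}` to the
face `{vᵢ = bᵢ}` — equivalently a closed edge-cutset (dually: a closed plaquette sheet anchored on
the four other faces) separates the two `i`-faces. -/
def sh (a b : Site 3) (i : Fin 3) : Set (BondConfig (Site 3)) :=
  {ω | ¬ ∃ x ∈ rect a b, ∃ y ∈ rect a b, x i = a i ∧ y i = b i ∧ ω ∈ openConnIn (rect a b) x y}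

/-- CHAIN (UNION-GLUING) LEMMA FOR CUTSETS (deterministic, provable now, any pair of directions
`i, j`): two boxes that are translates of each other along `j` and overlap in a slab of positive
`j`-width, each with an `i`-cutset, plus a `j`-cutset of the overlap, give an `i`-cutset of the
union.  (A path avoiding all three cannot pass between the two private parts — it would cross
the overlap between its `j`-faces — so it stays inside one box and meets that box's cutset.)
This is the separation-side replacement of "crossings of overlapping rectangles meet". -/
theorem chain_glue {a b a' b' : Site 3} {i j : Fin 3}
    (hk : ∀ k, k ≠ j → a' k = a k ∧ b' k = b k)
    (h1 : a j ≤ a' j) (h2 : a' j < b j) (h3 : b j ≤ b' j) :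
    sh a b i ∩ sh a' b' i ∩ sh a' b j ⊆ sh a b' i := by
  sorry

/-- The tube `[0, L] × [-n, n]²` and its lengthwise blocking event. -/
def tubeBlock (L n : ℕ) : Set (BondConfig (Site 3)) :=
  sh ![0, -(n : ℤ), -(n : ℤ)] ![(L : ℤ), (n : ℤ), (n : ℤ)] 0

/-- TUBE RATE (the transfer target `C⁺`; quasi-one-dimensional): for every `ε > 0`, eventually the
critical tube of aspect ratio `n^ε` has NO lengthwise open crossing with probability `≥ 1/2`,
i.e. the correlation length of the `n × n` tube at `p_c(ℤ³)` is `≤ n^{1+ε}`. -/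
def TubeRate : Prop :=
  ∀ ε : ℝ, 0 < ε → ∀ᶠ n : ℕ in atTop, (1 / 2 : ℝ) ≤ μc.real (tubeBlock ⌈(n : ℝ) ^ (1 + ε)⌉₊ n)

/-- NECESSITY (provable now): a lengthwise tube crossing crosses the disjoint annuli
`x + A(n,2n)`, `x ∈ (4n+1)ℕ e₀`, which are independent; so `μc(tube crossed) ≤ (1-u_n)^{⌊L/(4n+1)⌋-1}`
and `u_n ≥ n^{-s}` forces `TubeRate` (with `ε > s`).  Hence the crux IMPLIES `TubeRate`. -/
theorem tubeRate_of_subpolynomialBlocking :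
    Theses.PercNonProliferation.SubpolynomialBlocking → TubeRate := by
  sorry

/-- CUTSET-RSW (the lever; conjectured dimension-free lemma — the 2D case is RSW + duality): the
ratio-2 annulus blocking probability at scale `n` is polynomially lower-bounded in `n/L` as soon as
the tube `[0,L] × [-n,n]²` is lengthwise blocked with probability `≥ 1/2`.  (Anti-monotone
direction: long cutsets ⇒ short/round cutsets; Duncan–Kahle–Schweinhart 2025 §8 name the
"high-dimensional Russo–Seymour–Welsh method" as missing.) -/
def CutsetRSW : Prop :=
  ∃ C c : ℝ, 0 < c ∧ ∀ n L : ℕ, 1 ≤ n → n ≤ L →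
    (1 / 2 : ℝ) ≤ μc.real (tubeBlock L n) → c * ((n : ℝ) / L) ^ C ≤ μc.real (blockEv n)

/-- SUFFICIENCY (bookkeeping, provable now): `CutsetRSW ∧ TubeRate ⇒ u_n ≥ c·n^{-Cε}·(const)`
eventually, for every `ε > 0`, i.e. the crux.  So, modulo `CutsetRSW`, the crux is EQUIVALENT to
the quasi-1D statement `TubeRate`. -/
theorem subpolynomialBlocking_of_cutsetRSW_tubeRate :
    CutsetRSW → TubeRate → Theses.PercNonProliferation.SubpolynomialBlocking := by
  rintro ⟨C, c, hc, hR⟩ hT s hs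
  set C' : ℝ := max C 1 with hC'def
  have hC'1 : 1 ≤ C' := le_max_right _ _
  have hC'pos : 0 < C' := lt_of_lt_of_le one_pos hC'1
  have hCC' : C ≤ C' := le_max_left _ _
  set ε : ℝ := s / (2 * C') with hεdef
  have hεpos : 0 < ε := div_pos hs (by positivity)
  have hεC : ε * C' = s / 2 := by rw [hεdef]; field_simp
  have hlim : Tendsto (fun n : ℕ => ((n : ℝ)) ^ (s / 2)) atTop atTop :=
    (tendsto_rpow_atTop (by positivity : 0 < s / 2)).comp tendsto_natCast_atTop_atTop
  filter_upwards [hT ε hεpos, eventually_ge_atTop 1, hlim.eventually_ge_atTop ((2 : ℝ) ^ C' / c)]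
    with n hn hn1 hbig
  -- basic positivity
  have hn1R : (1 : ℝ) ≤ n := by exact_mod_cast hn1
  have hnpos : (0 : ℝ) < n := by linarith
  -- the length L = ⌈n^{1+ε}⌉ and n ≤ L
  set L : ℕ := ⌈(n : ℝ) ^ (1 + ε)⌉₊ with hLdef
  have hpow1 : (n : ℝ) ≤ (n : ℝ) ^ (1 + ε) := by
    conv_lhs => rw [← Real.rpow_one (n : ℝ)]
    exact Real.rpow_le_rpow_of_exponent_le hn1R (by linarith)
  have hLreal : (n : ℝ) ^ (1 + ε) ≤ (L : ℝ) := Nat.le_ceil _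
  have hnL : n ≤ L := by exact_mod_cast hpow1.trans hLreal
  have hLpos : (0 : ℝ) < L := lt_of_lt_of_le hnpos (by exact_mod_cast hnL)
  have key := hR n L hn1 hnL hn
  -- r := n / L satisfies n^{-ε}/2 ≤ r ≤ 1
  have hpowpos : (0 : ℝ) < (n : ℝ) ^ (1 + ε) := Real.rpow_pos_of_pos hnpos _
  have hLle : (L : ℝ) ≤ 2 * (n : ℝ) ^ (1 + ε) := by
    have h1 : (L : ℝ) < (n : ℝ) ^ (1 + ε) + 1 := Nat.ceil_lt_add_one hpowpos.le
    have h2 : (1 : ℝ) ≤ (n : ℝ) ^ (1 + ε) := Real.one_le_rpow hn1R (by linarith)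
    linarith
  have hr1 : (n : ℝ) / L ≤ 1 := by
    rw [div_le_one hLpos]; exact_mod_cast hnL
  have hrpos : 0 < (n : ℝ) / L := div_pos hnpos hLpos
  have hrlow : (n : ℝ) ^ (-ε) / 2 ≤ (n : ℝ) / L := by
    have : (n : ℝ) ^ (-ε) / 2 = (n : ℝ) / (2 * (n : ℝ) ^ (1 + ε)) := by
      rw [Real.rpow_neg hnpos.le, Real.rpow_add hnpos, Real.rpow_one]
      field_simp
    rw [this]
    exact div_le_div_of_nonneg_left hnpos.le hLpos hLle
  -- compare powers
  have hA : ((n : ℝ) / L) ^ C' ≤ ((n : ℝ) / L) ^ C :=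
    Real.rpow_le_rpow_of_exponent_ge hrpos hr1 hCC'
  have hB : ((n : ℝ) ^ (-ε) / 2) ^ C' ≤ ((n : ℝ) / L) ^ C' :=
    Real.rpow_le_rpow (by positivity) hrlow hC'pos.le
  have hBval : ((n : ℝ) ^ (-ε) / 2) ^ C' = (n : ℝ) ^ (-(s / 2)) / (2 : ℝ) ^ C' := by
    rw [Real.div_rpow (Real.rpow_nonneg hnpos.le _) (by norm_num), ← Real.rpow_mul hnpos.le]
    congr 2
    rw [neg_mul, hεC]
  -- n^{-(s/2)} ≤ c / 2^{C'}
  have h2pos : (0 : ℝ) < (2 : ℝ) ^ C' := Real.rpow_pos_of_pos (by norm_num) _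
  have hsmall : (n : ℝ) ^ (-(s / 2)) ≤ c / (2 : ℝ) ^ C' := by
    have hq : (0 : ℝ) < (2 : ℝ) ^ C' / c := div_pos h2pos hc
    have hbig' : (2 : ℝ) ^ C' / c ≤ (n : ℝ) ^ (s / 2) := by simpa using hbig
    rw [Real.rpow_neg hnpos.le]
    calc ((n : ℝ) ^ (s / 2))⁻¹ ≤ ((2 : ℝ) ^ C' / c)⁻¹ := inv_anti₀ hq hbig'
      _ = c / (2 : ℝ) ^ C' := by rw [inv_div]
  have hnneg : 0 ≤ (n : ℝ) ^ (-(s / 2)) := Real.rpow_nonneg hnpos.le _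
  -- assemble
  have hsplit : (n : ℝ) ^ (-s) = (n : ℝ) ^ (-(s / 2)) * (n : ℝ) ^ (-(s / 2)) := by
    rw [← Real.rpow_add hnpos]; ring_nf
  calc (n : ℝ) ^ (-s) = (n : ℝ) ^ (-(s / 2)) * (n : ℝ) ^ (-(s / 2)) := hsplit
    _ ≤ (c / (2 : ℝ) ^ C') * (n : ℝ) ^ (-(s / 2)) := mul_le_mul_of_nonneg_right hsmall hnneg
    _ = c * ((n : ℝ) ^ (-(s / 2)) / (2 : ℝ) ^ C') := by ring
    _ = c * (((n : ℝ) ^ (-ε) / 2) ^ C') := by rw [hBval]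
    _ ≤ c * (((n : ℝ) / L) ^ C') := mul_le_mul_of_nonneg_left hB hc.le
    _ ≤ c * (((n : ℝ) / L) ^ C) := mul_le_mul_of_nonneg_left hA hc.le
    _ ≤ μc.real (blockEv n) := key

end Summit.CriticalPhenomena.PercolationContinuityZ3.Cruxes.SubpolynomialBlocking.Ideate2

end
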